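import Summits.NavierStokesRegularity.FluidComputer.PalasekTowerRegisterGlobalFloorsAt
import Summits.NavierStokesRegularity.NavierStokesRegularity.Theorems.HeredityAtOne.Negative.CoreLedgerWinding
import Literature.Analysis.FluidPDE.VorticityCalculus

/-!
# REGISTER v2.3′: the FLUX FORM of the core floor — a disc of radius `1/N_{k+1}` with normal vorticity
# `≥ c₁ A_{k+1}/(4π)` carries the registered core loop (Stokes on the disc, wound four times)

Cell `ns-blowup`, seat `ns-palasek-19249-p2` (prover; D-0081 §C stub-worker on item
stmt-NavierStokesRegularity-19249 `HeredityAtOne`; registered stub `stub_core_floor_at_one : CoreFloorAt 1` of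
the line birth v3). Companion of `PalasekTowerRegisterGlobalFloorsAt.lean` (this seat, p452333: `CoreFloorAt k`,
`ReadoutAt k P`), of refuter4's K57-W `Theorems/HeredityAtOne/Negative/CoreLedgerWinding.lean` (p432770: the
registered core clause pins no winding number — `coreLoop_of_winding`: `1/m` of the circulation floor on a loop
of `1/m` of the speed budget, wound `m` times, meets the clause) and of the Literature Stokes theorem for planar
discs `circulation_circleLoop_eq_integral_curl` (`LoopCirculation.lean`). LABEL: E–C typing (KINEMATICS: a
Stokes lower bound and its register reading; every statement proved, no definition, no named fact). WHAT THIS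
IS NOT: not Navier–Stokes evidence — nothing is said about any flow; no stage is constructed; the stub stays OPEN.

## What is proved, and why

K57-W reads the core clause of the register (a `C¹` closed loop in a ball of radius `1/N` centred in the tower's
ball, speed `≤ 8π/N`, circulation `≥ c₁ N^{β-2}`) as an AMPLITUDE floor rather than a circulation floor. This
file makes the amplitude reading USABLE IN THE POSITIVE DIRECTION, in the vocabulary of vorticity:

* §1 `le_circulation_circleLoop_of_le_curl` (any `C¹` field `w` on `ℝ³`, any centre and frame, `R ≥ 0`): if the
  normal vorticity `⟪curl w, e₁ × e₂⟫` is `≥ Ω` at every point `c + (ρ cos θ) e₁ + (ρ sin θ) e₂`, `0 ≤ ρ ≤ R`, then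
  `π Ω R² ≤ ∮_{circle(c, R)} w · dℓ` (Stokes on the disc + monotonicity of the polar integral);
* §2 `coreClause_of_vorticityDisc` (any rates, any schedule, any level `j`): a `C¹` field whose normal vorticity
  is `≥ c₁ A_j / (4π)` on a disc of radius `1/N_j` (orthonormal frame) centred at a point of the tower's ball
  meets the level-`j` CORE CLAUSE — the circle of radius `1/N_j` wound FOUR times has speed exactly `8π/N_j` and
  circulation `4 · π · (c₁ A_j/(4π)) / N_j² = c₁ N_j^{β-2}`;
* §3 **`coreFloorAt_of_vorticityDisc`**: `CoreFloorAt k` follows from the FLUX-FORM readout «every tame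
  continuation of every registered level-`k` stage carries at `τ (k+1)` a vorticity disc of radius `1/N_{k+1}`
  centred in the ball with normal vorticity `≥ c₁ A_{k+1}/(4π)` throughout» (`VorticityDisc`-shaped `ReadoutAt`,
  no new definition); at `k = 1` the threshold is `A₂/(4π) ∈ (4.00·10⁵, 4.01·10⁵)` on a disc of radius
  `1/N₂ ≈ 1.2·10⁻³` (`coreFloorAt_one_of_vorticityDisc`, `wide_A_two_div_four_pi_bounds`).

So a prover (or a certified profile) exhibiting an `N₂`-VORTEX CORE in the plain sense — vorticity at least
`A₂/(4π)` across a disc of radius `1/N₂` — discharges the core stub's conclusion for that run; the loop search and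
the winding bookkeeping are absorbed here once and for all.

References: A. J. Majda, A. L. Bertozzi, *Vorticity and Incompressible Flow*, CUP 2002, §1.6 (1.60)–(1.61), §1.7
[cite: MajdaBertozziCUP2002, §1.6]; S. Palasek, arXiv:2605.13827 §3.1 [cite: Palasek2026ElementaryModel, §3.1].
-/

noncomputable section

namespace Summit.NavierStokesRegularity.FluidComputer.PalasekTowerClayBridge

open Set MeasureTheory Filter Topology Function Real intervalIntegral
open scoped ENNReal ContDiff NNReal InnerProductSpace RealInnerProductSpace
open Literature.Analysis.FluidPDE
open Summit.NavierStokesRegularity.CoreLedgerWinding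

/-! ## §1 Stokes lower bound: a vorticity floor on a disc bounds the circulation of its rim from below -/

/-- **Vorticity floor on a disc ⇒ circulation floor on its rim.** For a `C¹` field `w` on `ℝ³`, a centre `c`,
a frame `(e₁, e₂)` and `R ≥ 0`: if `Ω ≤ ⟪curl w (c + (ρ cos θ) e₁ + (ρ sin θ) e₂), e₁ × e₂⟫` for all
`ρ ∈ [0, R]` and all `θ`, then `π Ω R² ≤ ∮_{circleLoop c R e₁ e₂} w · dℓ` (Stokes for planar discs,
`circulation_circleLoop_eq_integral_curl`, and monotonicity of the iterated polar integral).
[cite: MajdaBertozziCUP2002, §1.6] -/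
theorem le_circulation_circleLoop_of_le_curl
    {w : EuclideanSpace ℝ (Fin 3) → EuclideanSpace ℝ (Fin 3)} (hw : ContDiff ℝ 1 w)
    (c e₁ e₂ : EuclideanSpace ℝ (Fin 3)) {R Ω : ℝ} (hR : 0 ≤ R)
    (hΩ : ∀ ρ ∈ Icc 0 R, ∀ θ : ℝ,
      Ω ≤ ⟪curl w (c + (ρ * cos θ) • e₁ + (ρ * sin θ) • e₂), cross e₁ e₂⟫) :
    π * Ω * R ^ 2 ≤ circulation w (circleLoop c R e₁ e₂) := by
  rw [circulation_circleLoop_eq_integral_curl hw]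
  -- the integrand is jointly continuous
  set g : ℝ → ℝ → ℝ := fun ρ θ =>
    ρ * ⟪curl w (c + (ρ * cos θ) • e₁ + (ρ * sin θ) • e₂), cross e₁ e₂⟫ with hgdef
  have hpt : Continuous (fun z : ℝ × ℝ => c + (z.1 * cos z.2) • e₁ + (z.1 * sin z.2) • e₂) := by
    fun_prop
  have hcurl : Continuous (curl w) := continuous_curl hw
  have hg : Continuous (uncurry g) := by
    have h1 : Continuous (fun z : ℝ × ℝ =>
        ⟪curl w (c + (z.1 * cos z.2) • e₁ + (z.1 * sin z.2) • e₂), cross e₁ e₂⟫) :=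
      (hcurl.comp hpt).inner continuous_const
    exact continuous_fst.mul h1
  -- inner (angular) integral: `2π ρ Ω ≤ ∫₀^{2π} g ρ θ dθ` for `0 ≤ ρ ≤ R`
  have hinner : ∀ ρ ∈ Icc 0 R, 2 * π * (ρ * Ω) ≤ ∫ θ in (0 : ℝ)..2 * π, g ρ θ := by
    intro ρ hρ
    have hgi : IntervalIntegrable (g ρ) volume 0 (2 * π) :=
      (hg.comp (Continuous.prodMk_right ρ)).intervalIntegrable _ _
    have hconst : ∫ _ in (0 : ℝ)..2 * π, ρ * Ω = 2 * π * (ρ * Ω) := by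
      rw [intervalIntegral.integral_const]; simp
    rw [← hconst]
    refine intervalIntegral.integral_mono_on (by positivity) intervalIntegrable_const hgi fun θ _ => ?_
    exact mul_le_mul_of_nonneg_left (hΩ ρ hρ θ) hρ.1
  -- outer (radial) integral
  have hF : Continuous (fun ρ => ∫ θ in (0 : ℝ)..2 * π, g ρ θ) :=
    intervalIntegral.continuous_parametric_intervalIntegral_of_continuous' hg 0 (2 * π)
  have hlin : ∫ ρ in (0 : ℝ)..R, 2 * π * (ρ * Ω) = π * Ω * R ^ 2 := by
    have h1 : (fun ρ : ℝ => 2 * π * (ρ * Ω)) = fun ρ => (2 * π * Ω) * ρ := by funext ρ; ring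
    rw [h1, intervalIntegral.integral_const_mul, integral_id]
    ring
  rw [← hlin]
  exact intervalIntegral.integral_mono_on hR
    ((by fun_prop : Continuous fun ρ : ℝ => 2 * π * (ρ * Ω)).intervalIntegrable _ _)
    (hF.intervalIntegrable _ _) fun ρ hρ => hinner ρ hρ

/-! ## §2 Register reading: a vorticity disc of radius `1/N_j` carries the level-`j` core clause -/

/-- In an orthonormal frame, `‖a e₁ + b e₂‖² = a² + b²`. [folklore] -/
theorem norm_sq_frame {e₁ e₂ : EuclideanSpace ℝ (Fin 3)} (he₁ : ‖e₁‖ = 1) (he₂ : ‖e₂‖ = 1)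
    (h12 : ⟪e₁, e₂⟫ = 0) (a b : ℝ) : ‖a • e₁ + b • e₂‖ ^ 2 = a ^ 2 + b ^ 2 := by
  rw [norm_add_sq_real, norm_smul, norm_smul, he₁, he₂, real_inner_smul_left, real_inner_smul_right, h12,
    Real.norm_eq_abs, Real.norm_eq_abs]
  simp [sq_abs]

/-- In an orthonormal frame the planar circle of radius `r ≥ 0` stays at distance exactly `r` from its centre.
[folklore] -/
theorem norm_circleLoop_sub_centre_frame {e₁ e₂ : EuclideanSpace ℝ (Fin 3)} (he₁ : ‖e₁‖ = 1)
    (he₂ : ‖e₂‖ = 1) (h12 : ⟪e₁, e₂⟫ = 0) (c : EuclideanSpace ℝ (Fin 3)) {r : ℝ} (hr : 0 ≤ r) (s : ℝ) :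
    ‖circleLoop c r e₁ e₂ s - c‖ = r := by
  have h1 : circleLoop c r e₁ e₂ s - c =
      (r * cos (2 * π * s)) • e₁ + (r * sin (2 * π * s)) • e₂ := by
    rw [circleLoop_apply]; abel
  have h2 : ‖circleLoop c r e₁ e₂ s - c‖ ^ 2 = r ^ 2 := by
    rw [h1, norm_sq_frame he₁ he₂ h12]
    nlinarith [sin_sq_add_cos_sq (2 * π * s)]
  rw [← Real.sqrt_sq (norm_nonneg _), h2, Real.sqrt_sq hr]

/-- In an orthonormal frame the planar circle of radius `r ≥ 0` has speed exactly `2π r`. [folklore] -/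
theorem norm_deriv_circleLoop_frame {e₁ e₂ : EuclideanSpace ℝ (Fin 3)} (he₁ : ‖e₁‖ = 1)
    (he₂ : ‖e₂‖ = 1) (h12 : ⟪e₁, e₂⟫ = 0) (c : EuclideanSpace ℝ (Fin 3)) {r : ℝ} (hr : 0 ≤ r) (s : ℝ) :
    ‖deriv (circleLoop c r e₁ e₂) s‖ = 2 * π * r := by
  rw [deriv_circleLoop, norm_smul, Real.norm_eq_abs, abs_of_pos Real.two_pi_pos]
  congr 1
  have h2 : ‖(-(r * sin (2 * π * s))) • e₁ + (r * cos (2 * π * s)) • e₂‖ ^ 2 = r ^ 2 := by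
    rw [norm_sq_frame he₁ he₂ h12]
    nlinarith [sin_sq_add_cos_sq (2 * π * s)]
  rw [← Real.sqrt_sq (norm_nonneg _), h2, Real.sqrt_sq hr]

/-- **THE FLUX FORM OF THE CORE CLAUSE** (any rates `R`, any schedule `S`, any level `j`). Let `w` be a `C¹` field
on `ℝ³`, `x` a point of the tower's ball, `(e₁, e₂)` an orthonormal frame, and suppose the normal vorticity is at
least `c₁ A_j / (4π)` on the disc of radius `1/N_j` about `x` in the plane of the frame:
`c₁ A_j/(4π) ≤ ⟪curl w (x + (ρ cos θ) e₁ + (ρ sin θ) e₂), e₁ × e₂⟫` for `0 ≤ ρ ≤ 1/N_j`. Then `w` meets the level-`j`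
CORE CLAUSE of the register: the rim circle wound four times is a `C¹` closed loop in `closedBall x (1/N_j)` of
speed `8π/N_j` with circulation `4 · π (c₁ A_j/(4π)) / N_j² = c₁ N_j^{β-2}` (`le_circulation_circleLoop_of_le_curl`,
K57-W's `coreLoop_of_winding`). [cite: MajdaBertozziCUP2002, §1.6] -/
theorem coreClause_of_vorticityDisc {R : TowerRates} (S : Schedule R) (j : ℕ)
    {w : EuclideanSpace ℝ (Fin 3) → EuclideanSpace ℝ (Fin 3)} (hw : ContDiff ℝ 1 w)
    {x e₁ e₂ : EuclideanSpace ℝ (Fin 3)} (hx : ‖x‖ ≤ S.radius) (he₁ : ‖e₁‖ = 1) (he₂ : ‖e₂‖ = 1)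
    (h12 : ⟪e₁, e₂⟫ = 0)
    (hΩ : ∀ ρ ∈ Icc 0 (1 / R.N j), ∀ θ : ℝ,
      S.c₁ * R.A j / (4 * π) ≤ ⟪curl w (x + (ρ * cos θ) • e₁ + (ρ * sin θ) • e₂), cross e₁ e₂⟫) :
    ∃ (x' : EuclideanSpace ℝ (Fin 3)) (γ : ℝ → EuclideanSpace ℝ (Fin 3)),
      ‖x'‖ ≤ S.radius ∧ ContDiff ℝ 1 γ ∧ γ 0 = γ 1 ∧
      (∀ σ ∈ Icc (0 : ℝ) 1, γ σ ∈ Metric.closedBall x' (1 / R.N j)) ∧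
      (∀ σ ∈ Icc (0 : ℝ) 1, ‖deriv γ σ‖ ≤ 8 * π / R.N j) ∧
      S.c₁ * R.N j ^ (R.β - 2) ≤ circulation w γ := by
  have hN := R.N_pos j
  have hr : 0 ≤ 1 / R.N j := by positivity
  -- Stokes: the rim circle carries a quarter of the floor
  have hcirc : π * (S.c₁ * R.A j / (4 * π)) * (1 / R.N j) ^ 2 ≤
      circulation w (circleLoop x (1 / R.N j) e₁ e₂) :=
    le_circulation_circleLoop_of_le_curl hw x e₁ e₂ hr hΩ
  have hquarter : π * (S.c₁ * R.A j / (4 * π)) * (1 / R.N j) ^ 2 = S.c₁ * R.N j ^ (R.β - 2) / 4 := by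
    rw [R.A_eq_rpow_mul_N_sq j]
    field_simp
  rw [hquarter] at hcirc
  -- wind four times
  obtain ⟨γ, hγ, hloop, hball, hspeed, hΓ⟩ := coreLoop_of_winding (S := S) (j := j) hw.continuous
    (m := 4) (by norm_num) (contDiff_circleLoop x (1 / R.N j) e₁ e₂) (periodic_circleLoop x (1 / R.N j) e₁ e₂)
    (fun σ => by
      rw [Metric.mem_closedBall, dist_eq_norm, norm_circleLoop_sub_centre_frame he₁ he₂ h12 x hr])
    (fun σ => by
      rw [norm_deriv_circleLoop_frame he₁ he₂ h12 x hr]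
      apply le_of_eq; push_cast; field_simp; ring)
    (by push_cast; linarith)
  exact ⟨x, γ, hx, hγ, hloop, hball, hspeed, hΓ⟩

/-! ## §3 The core stub from the flux-form readout -/

/-- **`CoreFloorAt k` FROM THE FLUX FORM.** If every tame continuation of every registered level-`k` stage of a
pinned rigid quiet wide design carries at `τ (k+1)` a VORTICITY DISC — a point `x` of the ball and an orthonormal
frame `(e₁, e₂)` with normal vorticity `≥ c₁ A_{k+1}/(4π)` on the disc of radius `1/N_{k+1}` about `x` — then
`CoreFloorAt k` (the slice is `C¹`, being a slice of a classical solution; `coreClause_of_vorticityDisc`).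
[cite: MajdaBertozziCUP2002, §1.6] -/
theorem coreFloorAt_of_vorticityDisc {k : ℕ}
    (h : ReadoutAt k (fun S v => ∃ x e₁ e₂ : EuclideanSpace ℝ (Fin 3),
      ‖x‖ ≤ S.radius ∧ ‖e₁‖ = 1 ∧ ‖e₂‖ = 1 ∧ ⟪e₁, e₂⟫ = 0 ∧
      ∀ ρ ∈ Icc 0 (1 / TowerRates.wide.N (k + 1)), ∀ θ : ℝ,
        S.c₁ * TowerRates.wide.A (k + 1) / (4 * π) ≤
          ⟪curl v (x + (ρ * cos θ) • e₁ + (ρ * sin θ) • e₂), cross e₁ e₂⟫)) :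
    CoreFloorAt k := by
  intro S hP hR hQ s u p hcl hagree hE hceil
  obtain ⟨x, e₁, e₂, hx, he₁, he₂, h12, hΩ⟩ := h S hP hR hQ s u p hcl hagree hE hceil
  have hC1 : ContDiff ℝ 1 (u (S.τ (k + 1))) :=
    (hcl.contDiff_velocity (t := S.τ (k + 1)) ⟨(S.τ_pos _).le, le_rfl⟩).of_le (by norm_cast)
  exact coreClause_of_vorticityDisc S (k + 1) hC1 hx he₁ he₂ h12 hΩ

/-- Certified: at the first hand-over the flux-form threshold is `A₂/(4π) ∈ (4.00·10⁵, 4.01·10⁵)`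
(`A₂ ∈ (5036534, 5036535)`, `3.14 < π < 3.1416`). [folklore] -/
theorem wide_A_two_div_four_pi_bounds :
    (400000 : ℝ) < TowerRates.wide.A 2 / (4 * π) ∧ TowerRates.wide.A 2 / (4 * π) < 401000 := by
  obtain ⟨hA, hA'⟩ := TowerRates.wide_A_two_bounds
  have hπ := Real.pi_gt_d2
  have hπ' := Real.pi_lt_d4
  have h4 : 0 < 4 * π := by positivity
  constructor
  · rw [lt_div_iff₀ h4]; nlinarith
  · rw [div_lt_iff₀ h4]; nlinarith

/-- **THE FIRST RUNG (item 19249, stub `stub_core_floor_at_one`) from the flux form**: if every tame continuation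
of every registered level-1 stage carries at `τ₂` a disc of radius `1/N₂ ≈ 1.2·10⁻³` centred in the ball with normal
vorticity `≥ A₂/(4π) ≈ 4.0·10⁵` throughout (`c₁ = 1`), then `CoreFloorAt 1`. [cite: MajdaBertozziCUP2002, §1.6] -/
theorem coreFloorAt_one_of_vorticityDisc
    (h : ReadoutAt 1 (fun S v => ∃ x e₁ e₂ : EuclideanSpace ℝ (Fin 3),
      ‖x‖ ≤ S.radius ∧ ‖e₁‖ = 1 ∧ ‖e₂‖ = 1 ∧ ⟪e₁, e₂⟫ = 0 ∧
      ∀ ρ ∈ Icc 0 (1 / TowerRates.wide.N 2), ∀ θ : ℝ,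
        S.c₁ * TowerRates.wide.A 2 / (4 * π) ≤
          ⟪curl v (x + (ρ * cos θ) • e₁ + (ρ * sin θ) • e₂), cross e₁ e₂⟫)) :
    CoreFloorAt 1 :=
  coreFloorAt_of_vorticityDisc h

end Summit.NavierStokesRegularity.FluidComputer.PalasekTowerClayBridge

end
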